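/-
Copyright (c) 2026 the pub-hodgecm-mathlib formalisation cell (harness21).  Prover seat hodgecm-mathlib-LH4-p15 (g2), req620 Track A «(D-RAM) FOUR-FRAME» squad
(STAGE-1b, row (2) of the piece `f_{T₊}`, the (β₂) road (R-36) «PURE-CELL LEDGER»; β₂ sub-dealer LH4-p04 (g10) WORD #24 letter ‹TERM.letter.v2›, holder LH4-p15: the E-side
base count of the terminal cell), 2026-09-05.
-/
import Summits.HodgeConjecture.HodgeConjecture.Theorems.F0P3cDyRamGlueClassCharSums          -- ★ (LH7-p07 lineage): (s2) `sum_normSign_one_add_mul_repr_ball_eq_zero` (the conductor-ball sum `Σ_{b ∈ 𝔭_F} ω(1 + θb) = 0`)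
import Summits.HodgeConjecture.HodgeConjecture.Theorems.F0P3cDyRamDiagonalCellLabelDigits      -- ★ p862655 (LH4-p19 (g2)): `sum_normSign_eq_card_sub_card`; brings ★ `normSign_eq_one_or`, ★ Lit ω-conductor toolkit
import HarnessLib

/-!
# Crux `H413`, line LH4 «(D-RAM) FOUR-FRAME» — STAGE-1b, row (2), the (β₂) road (R-36), row (ROW-TERM)′: «THE UNIT AFFINE LABEL IS BALANCED OFF ITS NON-UNIT TOP DIGIT» —
# the E-side base count of the TERMINAL cell (depth `g = 0`): for `σ`-fixed `α₁, γ₁` with `|γ₁| ≤ 1` and ANY literal predicate constant on top-digit classes,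
# `#{V ∈ R_d ∣ LIT V ∧ |α₁ + γ₁V| = 1 ∧ ω(α₁ + γ₁V) = 1} = #{V ∈ R_d ∣ LIT V ∧ |α₁ + γ₁V| = 1 ∧ ω(α₁ + γ₁V) ≠ 1}`

Cell `hodgecm-mathlib` (D-0151), FLOOR 0, crux item H413 = `stmt-HodgeConjecture-24833`, route of record `HCCMUnconditional`; squad F0∕P3c∕LH4; lane
`--supports stmt-HodgeConjecture-24833 --as helper` (count-neutral; pays NO tier-0 row).  THEOREMS ONLY (no `def`, no instance, no notation, no `sorry`, default heartbeats);
★-only imports; states NO law; (β₂) stays a HYPOTHESIS.  DATUM-FREE E-side algebra: one valued field `K` with the sheet datum `IsRamifiedQuadraticDatum σ ϖ d t` (complete,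
finite residue field, `|2| < 1`, `2 ≤ d`); no lattice, no line model.

WHY (β₂ WORD #24 ‹TERM.letter.v2›; this seat 00:41:53Z (T-c); LH4-p19 (g2)'s ★ p863833 `cellDiff_eq_zero_of_fibration_reads₃` asks for `hbase : #(((Rd.filter LIT).filter NX).filter ψ)
= #(((Rd.filter LIT).filter NX).filter ¬ψ)`).  On the terminal cell `j + b = jl` of the live row the label of a populated glued vertex is `ω(T̂)·ω(α₁ + γ₁V̂)` with `V̂` a
`σ`-fixed UNIT digit and `|γ₁| = 1` — depth `g = 0`, where LH4-p19's ★ K6a `card_filter_affine_plus_eq_card_filter_not` (`1 ≤ g ≤ d − 1`: the label depends on a COARSER digit than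
the literal) does not apply, and where the affine value `α₁ + γ₁V̂` is NOT always a unit: the vertices of the one top-digit class `V̂ ≡ −α₁∕γ₁ (𝔭_F)` are the `X`-members (off both
shells, ★ `…RowVertexRayDichotomy` §2), in neither literal set.  THIS FILE is the count that survives: partition the digit system `R_d` (fixed integers modulo `|·| ≤ |ϖ|^{2d}`) by the
TOP DIGIT (classes `|V − V′| ≤ |ϖ|²`, represented by `R′`); the literal `LIT` and the unit predicate `NX : |α₁ + γ₁V| = 1` are constant on classes; on a class `C = V₀ + 𝔭_F` with
`NX`, `α₁ + γ₁V = (α₁ + γ₁V₀)·(1 + θ(V − V₀))`, `θ = γ₁∕(α₁ + γ₁V₀)`, `|θ| ≤ 1`, and `{V − V₀ : V ∈ C ∩ R_d}` is a complete irredundant system of the ball `𝔭_F = {|b| ≤ |ϖ|²}`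
modulo `|ϖ|^{2d}`, so `Σ_{C ∩ R_d} ω(α₁ + γ₁V) = ω(α₁ + γ₁V₀)·Σ_b ω(1 + θb) = 0` by ★ (s2) `sum_normSign_one_add_mul_repr_ball_eq_zero` (`k = 1`, `k + 1 ≤ d`: `ω` is NOT trivial on
`U_F(2) = 1 + 𝔭_F` — the conductor is `𝔭_F^d`, `d ≥ 2`) and ★ `normSign_mul_of_fixed`; summing over the classes with `LIT ∧ NX` gives `Σ ω = 0` on `((R_d.filter LIT).filter NX)`,
i.e. the card equality (★ `sum_normSign_eq_card_sub_card`).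
* §1 `v_affine_eq_one_iff_of_near` (`NX` is a top-digit class function), `sum_normSign_affine_class_eq_zero` (one class with `NX` sums to `0`: factor `α₁ + γ₁V₀` out and
  apply ★ (s2) to the unit `θ = γ₁·(α₁ + γ₁V₀)⁻¹` — we assume `|γ₁| = 1`, the terminal cell's case; for `|γ₁| < 1` the class sum is `ω`-constant instead, not needed here).
* §2 HEAD `card_filter_unitAffine_plus_eq_card_filter_not` and its signed form `card_filter_unitAffine_eq_sign_eq_card_filter_ne` (`ψ := ω(α₁ + γ₁V) = s`, `s = ±1`).
WHAT IS NOT CLAIMED: which digits occur on the cell (the M-side reads), `|γ₁| < 1` (not the terminal cell), any census identity.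
HONEST LABEL.  Count-neutral local arithmetic; nothing printed is asserted; no census law is stated; ‹TERM.v2› stays OPEN; `HC_CM` is proved only modulo the 7 printed citations
(2 remaining named inputs: hLiu418 = `stmt-HodgeConjecture-24832`, h413 = `stmt-HodgeConjecture-24833`) until rung 0 closes.
## References
* [Serre1979] J.-P. Serre, *Local Fields*, GTM 67 (1979): Ch. V §3 Prop. 5, Cor. 2–3 pp. 85–87 (the conductor of a wild quadratic extension), Ch. XV §2 (`U^{(n)}` filtration).
* [LabesseLanglands1979] J.-P. Labesse, R. P. Langlands, *L-indistinguishability for SL(2)*, Canad. J. Math. 31 (1979): §2 (2.2) p. 9 (κ-signed counts).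
* [Kottwitz1986BaseChangeUnits] R. E. Kottwitz, *Base change for unit elements of Hecke algebras*, Compositio Math. 60 (1986): §1 pp. 240–241.
* [Rogawski1990] J. D. Rogawski, *Automorphic Representations of Unitary Groups in Three Variables*, Ann. of Math. Stud. 123 (1990): §4.9 Prop. 4.9.1 (b) p. 55.
-/

set_option autoImplicit false

noncomputable section

namespace Summit.HodgeConjecture.HodgeConjecture.Cruxes.H413.F0P3cDyRamUnitAffineDigitCount

open scoped Valued WithZero
open WithZero Finset
open Literature.NumberTheory.Automorphic.UnitaryThreeFourFrame (IsRamifiedQuadraticDatum normSign)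
open Literature.NumberTheory.LocalFields.WildQuadraticDatum (normSign_mul_of_fixed)
open Summit.HodgeConjecture.HodgeConjecture.Cruxes.H413.F0P3cDyRamGlueClassCharSums (sum_normSign_one_add_mul_repr_ball_eq_zero)
open Summit.HodgeConjecture.HodgeConjecture.Cruxes.H413.F0P3cDyRamDiagonalCellLabelDigits (sum_normSign_eq_card_sub_card)
open Summit.HodgeConjecture.HodgeConjecture.Cruxes.H413.F0P3cDyRamNormPairsIffFrames (normSign_eq_one_or)

variable {K : Type} [Field K] [Valued K ℤᵐ⁰] {σ : K →+* K} {ϖ : K} {d t : ℕ}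

/-! ## §1 The unit predicate is a top-digit class function; one class sums to zero -/

/-- For `|γ₁| ≤ 1` and `|V − V′| ≤ |ϖ|²` with `|ϖ| < 1`: `|α₁ + γ₁V| = 1 ↔ |α₁ + γ₁V′| = 1` (the two values differ by `γ₁(V − V′)`, of valuation `< 1`).
[cite: Serre1979, Ch. XV §2] -/
theorem v_affine_eq_one_iff_of_near (hϖlt : Valued.v ϖ < 1) {α₁ γ₁ : K} (hγ : Valued.v γ₁ ≤ 1)
    {V V' : K} (hnear : Valued.v (V - V') ≤ Valued.v ϖ ^ 2) :
    Valued.v (α₁ + γ₁ * V) = 1 ↔ Valued.v (α₁ + γ₁ * V') = 1 := by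
  have hsmall : Valued.v (γ₁ * (V - V')) < 1 := by
    rw [Valuation.map_mul]
    calc Valued.v γ₁ * Valued.v (V - V') ≤ 1 * Valued.v ϖ ^ 2 := mul_le_mul' hγ hnear
      _ < 1 := by rw [one_mul]; exact pow_lt_one₀ zero_le hϖlt (by norm_num)
  have e : α₁ + γ₁ * V = (α₁ + γ₁ * V') + γ₁ * (V - V') := by ring
  constructor
  · intro h
    by_contra hne
    have hlt : Valued.v (α₁ + γ₁ * V') < 1 := by
      rcases lt_or_eq_of_le (show Valued.v (α₁ + γ₁ * V') ≤ 1 from by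
        have e' : α₁ + γ₁ * V' = (α₁ + γ₁ * V) - γ₁ * (V - V') := by ring
        rw [e']; exact (Valuation.map_sub _ _ _).trans (max_le h.le hsmall.le)) with h' | h'
      · exact h'
      · exact absurd h' hne
    have : Valued.v (α₁ + γ₁ * V) < 1 := by rw [e]; exact (Valuation.map_add _ _ _).trans_lt (max_lt hlt hsmall)
    exact absurd h (ne_of_lt this)
  · intro h
    rw [e, Valuation.map_add_eq_of_lt_left _ (by rw [h]; exact hsmall), h]

/-- **ONE TOP-DIGIT CLASS WITH A UNIT VALUE SUMS TO ZERO.**  Sheet datum on a complete `K` with finite residue field, `|2| < 1`, `2 ≤ d`; `σ`-fixed `α₁, γ₁` with `|γ₁| = 1`; a `σ`-fixed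
integral `V₀` with `|α₁ + γ₁V₀| = 1`; `C` a finite set of `σ`-fixed integers `ϖ²`-close to `V₀` such that `{V − V₀ : V ∈ C}` is complete and irredundant modulo `|ϖ|^{2d}` in the
fixed ball `{|b| ≤ |ϖ|²}`.  THEN `Σ_{V ∈ C} ω(α₁ + γ₁V) = 0` (`α₁ + γ₁V = (α₁ + γ₁V₀)(1 + θ(V − V₀))`, ★ (s2) at `k = 1` and ★ multiplicativity of `ω`).
[cite: Serre1979, Ch. V §3 Cor. 3 pp. 85–87; Ch. XV §2] [cite: LabesseLanglands1979, §2 (2.2) p. 9] -/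
theorem sum_normSign_affine_class_eq_zero [CompleteSpace K] [Finite 𝓀[K]] (hD : IsRamifiedQuadraticDatum σ ϖ d t) (h2v : Valued.v (2 : K) < 1) (hd2 : 2 ≤ d)
    {α₁ γ₁ : K} (hσα : σ α₁ = α₁) (hσγ : σ γ₁ = γ₁) (hγ : Valued.v γ₁ = 1)
    {V₀ : K} (hσV₀ : σ V₀ = V₀) (hNX : Valued.v (α₁ + γ₁ * V₀) = 1)
    (C : Finset K) (hC1 : ∀ V ∈ C, σ V = V ∧ Valued.v (V - V₀) ≤ Valued.v ϖ ^ 2)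
    (hC2 : ∀ b : K, σ b = b → Valued.v b ≤ Valued.v ϖ ^ 2 → ∃ V ∈ C, Valued.v (b - (V - V₀)) ≤ Valued.v ϖ ^ (2 * d))
    (hC3 : ∀ V ∈ C, ∀ V' ∈ C, Valued.v ((V - V₀) - (V' - V₀)) ≤ Valued.v ϖ ^ (2 * d) → V = V') :
    ∑ V ∈ C, normSign σ (α₁ + γ₁ * V) = 0 := by
  classical
  have hϖ : Valued.v ϖ = exp (-1 : ℤ) := hD.2.2.1
  have hϖlt : Valued.v ϖ < 1 := by rw [hϖ, ← exp_zero, exp_lt_exp]; norm_num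
  set c : K := α₁ + γ₁ * V₀ with hc
  have hc0 : c ≠ 0 := fun h0 => by rw [h0, map_zero] at hNX; exact zero_ne_one hNX
  have hσc : σ c = c := by rw [hc, map_add, map_mul, hσα, hσγ, hσV₀]
  set θ : K := γ₁ / c with hθ
  have hσθ : σ θ = θ := by rw [hθ, map_div₀, hσγ, hσc]
  have hθ1 : Valued.v θ = 1 := by rw [hθ, map_div₀, hγ, hNX, div_one]
  -- the translated system
  set T : Finset K := C.image (fun V => V - V₀) with hT
  have hinj : Set.InjOn (fun V => V - V₀) ↑C := fun V _ V' _ h => by simpa using h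
  have hT1 : ∀ b ∈ T, σ b = b ∧ Valued.v b ≤ Valued.v ϖ ^ (2 * 1) := by
    intro b hb
    obtain ⟨V, hV, rfl⟩ := mem_image.1 hb
    obtain ⟨hσV, hnear⟩ := hC1 V hV
    exact ⟨by rw [map_sub, hσV, hσV₀], by rw [mul_one]; exact hnear⟩
  have hT2 : ∀ b : K, σ b = b → Valued.v b ≤ Valued.v ϖ ^ (2 * 1) → ∃ s ∈ T, Valued.v (b - s) ≤ Valued.v ϖ ^ (2 * d) := by
    intro b hσb hb
    obtain ⟨V, hV, h⟩ := hC2 b hσb (by rw [mul_one] at hb; exact hb)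
    exact ⟨V - V₀, mem_image.2 ⟨V, hV, rfl⟩, h⟩
  have hT3 : ∀ s ∈ T, ∀ s' ∈ T, Valued.v (s - s') ≤ Valued.v ϖ ^ (2 * d) → s = s' := by
    intro s hs s' hs' h
    obtain ⟨V, hV, rfl⟩ := mem_image.1 hs
    obtain ⟨V', hV', rfl⟩ := mem_image.1 hs'
    rw [hC3 V hV V' hV' h]
  have hball := sum_normSign_one_add_mul_repr_ball_eq_zero hD h2v hσθ hθ1 (k := 1) le_rfl (by omega) (N := 2 * d) (by omega) T hT1 hT2 hT3
  -- factor `α₁ + γ₁V = c·(1 + θ(V − V₀))`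
  have hcθ : c * θ = γ₁ := by rw [hθ]; field_simp
  have hfac : ∀ V : K, α₁ + γ₁ * V = c * (1 + θ * (V - V₀)) := fun V => by
    calc α₁ + γ₁ * V = c + γ₁ * (V - V₀) := by rw [hc]; ring
      _ = c * (1 + θ * (V - V₀)) := by rw [← hcθ]; ring
  have hterm : ∀ V ∈ C, normSign σ (α₁ + γ₁ * V) = normSign σ c * normSign σ (1 + θ * (V - V₀)) := by
    intro V hV
    obtain ⟨hσV, hnear⟩ := hC1 V hV
    have hσb : σ (1 + θ * (V - V₀)) = 1 + θ * (V - V₀) := by rw [map_add, map_one, map_mul, hσθ, map_sub, hσV, hσV₀]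
    have hb1 : Valued.v (1 + θ * (V - V₀)) = 1 := by
      refine Valued.v.map_one_add_of_lt ?_
      rw [Valuation.map_mul, hθ1, one_mul]
      exact lt_of_le_of_lt hnear (pow_lt_one₀ zero_le hϖlt (by norm_num))
    have hb0 : 1 + θ * (V - V₀) ≠ 0 := fun h0 => by rw [h0, map_zero] at hb1; exact zero_ne_one hb1
    rw [hfac V, normSign_mul_of_fixed hD hσc hσb hc0 hb0]
  have hreidx : ∑ V ∈ C, normSign σ (1 + θ * (V - V₀)) = ∑ b ∈ T, normSign σ (1 + θ * b) := by
    rw [hT, sum_image hinj]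
  rw [sum_congr rfl hterm, ← mul_sum, hreidx, hball, mul_zero]

/-! ## §2 HEAD — the count over the literal, unit-valued digits -/

/-- **HEAD — «THE UNIT AFFINE LABEL IS BALANCED OFF ITS NON-UNIT TOP DIGIT».**  Sheet datum `IsRamifiedQuadraticDatum σ ϖ d t` on a complete `K` with finite residue field,
`|2| < 1`, `2 ≤ d`; `σ`-fixed `α₁, γ₁` with `|γ₁| = 1`; `R_d` a complete irredundant system of the `σ`-fixed integers modulo `|·| ≤ |ϖ|^{2d}`, `R′` one modulo `|·| ≤ |ϖ|²` (the top
digits); a literal predicate `LIT` CONSTANT on top-digit classes of fixed integers.  THEN, with `NX V := |α₁ + γ₁V| = 1`,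
`#{V ∈ R_d ∣ LIT V ∧ NX V ∧ ω(α₁ + γ₁V) = 1} = #{V ∈ R_d ∣ LIT V ∧ NX V ∧ ¬ ω(α₁ + γ₁V) = 1}` — the `hbase` of ★ `…ConeCellCountSocketThree.cellDiff_eq_zero_of_fibration_reads₃`
for the terminal cell. [cite: Serre1979, Ch. V §3 Cor. 3 pp. 85–87; Ch. XV §2] [cite: LabesseLanglands1979, §2 (2.2) p. 9] [cite: Kottwitz1986BaseChangeUnits, §1 pp. 240–241] -/
theorem card_filter_unitAffine_plus_eq_card_filter_not [CompleteSpace K] [Finite 𝓀[K]] (hD : IsRamifiedQuadraticDatum σ ϖ d t) (h2v : Valued.v (2 : K) < 1)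
    (hd2 : 2 ≤ d) {α₁ γ₁ : K} (hσα : σ α₁ = α₁) (hσγ : σ γ₁ = γ₁) (hγ : Valued.v γ₁ = 1)
    (Rd : Finset K) (hRd1 : ∀ V ∈ Rd, σ V = V ∧ Valued.v V ≤ 1)
    (hRd2 : ∀ V : K, σ V = V → Valued.v V ≤ 1 → ∃ V₀ ∈ Rd, Valued.v (V - V₀) ≤ Valued.v ϖ ^ (2 * d))
    (hRd3 : ∀ V ∈ Rd, ∀ V' ∈ Rd, Valued.v (V - V') ≤ Valued.v ϖ ^ (2 * d) → V = V')
    (R' : Finset K) (hR'1 : ∀ V ∈ R', σ V = V ∧ Valued.v V ≤ 1)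
    (hR'2 : ∀ V : K, σ V = V → Valued.v V ≤ 1 → ∃ V₀ ∈ R', Valued.v (V - V₀) ≤ Valued.v ϖ ^ 2)
    (hR'3 : ∀ V ∈ R', ∀ V' ∈ R', Valued.v (V - V') ≤ Valued.v ϖ ^ 2 → V = V')
    (LIT : K → Prop) [DecidablePred LIT]
    (hLIT : ∀ V V' : K, σ V = V → Valued.v V ≤ 1 → σ V' = V' → Valued.v V' ≤ 1 → Valued.v (V - V') ≤ Valued.v ϖ ^ 2 → (LIT V ↔ LIT V')) :
    (((Rd.filter LIT).filter fun V => Valued.v (α₁ + γ₁ * V) = 1).filter fun V => normSign σ (α₁ + γ₁ * V) = 1).card =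
      (((Rd.filter LIT).filter fun V => Valued.v (α₁ + γ₁ * V) = 1).filter fun V => ¬ normSign σ (α₁ + γ₁ * V) = 1).card := by
  classical
  obtain ⟨hσσ, hvσ, hϖ, hfix, hdd, hd1, -⟩ := id hD
  have hϖlt : Valued.v ϖ < 1 := by rw [hϖ, ← exp_zero, exp_lt_exp]; norm_num
  have hϖ1 : Valued.v ϖ ≤ 1 := hϖlt.le
  have h2d : Valued.v ϖ ^ (2 * d) ≤ Valued.v ϖ ^ 2 := pow_le_pow_right_of_le_one' hϖ1 (by omega)
  set S : Finset K := (Rd.filter LIT).filter fun V => Valued.v (α₁ + γ₁ * V) = 1 with hS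
  have hSsub : S ⊆ Rd := (filter_subset _ _).trans (filter_subset _ _)
  -- the signed count is `Σ_{S} ω`; it suffices to show the sum vanishes
  have hsum0 : ∑ V ∈ S, normSign σ (α₁ + γ₁ * V) = 0 := by
    -- the top-digit map `π : Rd → R′`
    have hrep : ∀ V : K, ∃ V₀ : K, (σ V = V ∧ Valued.v V ≤ 1) → V₀ ∈ R' ∧ Valued.v (V - V₀) ≤ Valued.v ϖ ^ 2 := by
      intro V
      by_cases h : σ V = V ∧ Valued.v V ≤ 1
      · obtain ⟨V₀, hV₀, hVV₀⟩ := hR'2 V h.1 h.2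
        exact ⟨V₀, fun _ => ⟨hV₀, hVV₀⟩⟩
      · exact ⟨0, fun h' => absurd h' h⟩
    choose π hπ using hrep
    have hπR : ∀ V ∈ Rd, π V ∈ R' := fun V hV => (hπ V (hRd1 V hV)).1
    have hπnear : ∀ V ∈ Rd, Valued.v (V - π V) ≤ Valued.v ϖ ^ 2 := fun V hV => (hπ V (hRd1 V hV)).2
    rw [← sum_fiberwise_of_maps_to (s := S) (t := R') (g := π) (fun V hV => hπR V (hSsub hV))]
    refine sum_eq_zero fun y hy => ?_
    obtain ⟨hσy, hvy⟩ := hR'1 y hy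
    -- the fibre of `S` over `y`: either the whole `R_d`-class of `y` (when `LIT y ∧ NX y`) or empty
    by_cases hcls : LIT y ∧ Valued.v (α₁ + γ₁ * y) = 1
    · -- the class `C := {V ∈ Rd | π V = y}` and `S ∩ π⁻¹ y = C`
      have hfib : (S.filter fun V => π V = y) = Rd.filter fun V => π V = y := by
        ext V
        simp only [hS, mem_filter]
        constructor
        · rintro ⟨⟨⟨hV, -⟩, -⟩, hπV⟩; exact ⟨hV, hπV⟩
        · rintro ⟨hV, hπV⟩
          obtain ⟨hσV, hvV⟩ := hRd1 V hV
          have hnear : Valued.v (V - y) ≤ Valued.v ϖ ^ 2 := by rw [← hπV]; exact hπnear V hV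
          exact ⟨⟨⟨hV, (hLIT V y hσV hvV hσy hvy hnear).2 hcls.1⟩, (v_affine_eq_one_iff_of_near hϖlt hγ.le hnear).2 hcls.2⟩, hπV⟩
      rw [hfib]
      refine sum_normSign_affine_class_eq_zero hD h2v hd2 hσα hσγ hγ hσy hcls.2 _ (fun V hV => ?_) (fun b hσb hb => ?_) (fun V hV V' hV' h => ?_)
      · obtain ⟨hV, hπV⟩ := mem_filter.1 hV
        exact ⟨(hRd1 V hV).1, by rw [← hπV]; exact hπnear V hV⟩
      · -- completeness: represent `b + y` in `R_d`; its representative lies in the class of `y`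
        have hσby : σ (b + y) = b + y := by rw [map_add, hσb, hσy]
        have hvby : Valued.v (b + y) ≤ 1 := (Valuation.map_add _ _ _).trans (max_le (hb.trans (pow_le_one₀ zero_le hϖ1)) hvy)
        obtain ⟨V, hV, hbV⟩ := hRd2 (b + y) hσby hvby
        have hVy : Valued.v (V - y) ≤ Valued.v ϖ ^ 2 := by
          have e : V - y = b - (b + y - V) := by ring
          rw [e]; exact (Valuation.map_sub _ _ _).trans (max_le hb (hbV.trans h2d))
        have hπV : π V = y := hR'3 (π V) (hπR V hV) y hy (by
          have e : π V - y = (V - y) - (V - π V) := by ring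
          rw [e]; exact (Valuation.map_sub _ _ _).trans (max_le hVy (hπnear V hV)))
        refine ⟨V, mem_filter.2 ⟨hV, hπV⟩, ?_⟩
        have e : b - (V - y) = b + y - V := by ring
        rw [e]; exact hbV
      · have e : V - y - (V' - y) = V - V' := by ring
        rw [e] at h
        exact hRd3 V (mem_filter.1 hV).1 V' (mem_filter.1 hV').1 h
    · -- the fibre is empty
      have hfib : (S.filter fun V => π V = y) = ∅ := by
        refine filter_eq_empty_iff.2 fun V hV hπV => hcls ?_
        obtain ⟨⟨hVR, hLV⟩, hNV⟩ := by simpa only [hS, mem_filter] using hV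
        obtain ⟨hσV, hvV⟩ := hRd1 V hVR
        have hnear : Valued.v (V - y) ≤ Valued.v ϖ ^ 2 := by rw [← hπV]; exact hπnear V hVR
        exact ⟨(hLIT V y hσV hvV hσy hvy hnear).1 hLV, (v_affine_eq_one_iff_of_near hϖlt hγ.le hnear).1 hNV⟩
      rw [hfib, sum_empty]
  -- from the signed sum to the two cards
  rw [sum_normSign_eq_card_sub_card σ S (fun V => α₁ + γ₁ * V)] at hsum0
  have hfilt : (S.filter fun V => ¬ normSign σ (α₁ + γ₁ * V) = 1) = S.filter fun V => normSign σ (α₁ + γ₁ * V) = -1 := by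
    refine filter_congr fun V _ => ?_
    rcases normSign_eq_one_or σ (α₁ + γ₁ * V) with h | h
    · rw [h]; norm_num
    · rw [h]; norm_num
  rw [hfilt]
  omega

/-- **HEAD′ — SIGNED FORM**: for a sign `s` with `s = 1 ∨ s = −1` and `ψ V := ω(α₁ + γ₁V) = s`, `#{LIT ∧ NX ∧ ψ} = #{LIT ∧ NX ∧ ¬ψ}` on `R_d` (at `s = −1` the two sides of HEAD
swap, since `ω ∈ {±1}`). [cite: Serre1979, Ch. V §3 Cor. 3 pp. 85–87] [cite: LabesseLanglands1979, §2 (2.2) p. 9] -/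
theorem card_filter_unitAffine_eq_sign_eq_card_filter_ne [CompleteSpace K] [Finite 𝓀[K]] (hD : IsRamifiedQuadraticDatum σ ϖ d t) (h2v : Valued.v (2 : K) < 1)
    (hd2 : 2 ≤ d) {α₁ γ₁ : K} (hσα : σ α₁ = α₁) (hσγ : σ γ₁ = γ₁) (hγ : Valued.v γ₁ = 1)
    (Rd : Finset K) (hRd1 : ∀ V ∈ Rd, σ V = V ∧ Valued.v V ≤ 1)
    (hRd2 : ∀ V : K, σ V = V → Valued.v V ≤ 1 → ∃ V₀ ∈ Rd, Valued.v (V - V₀) ≤ Valued.v ϖ ^ (2 * d))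
    (hRd3 : ∀ V ∈ Rd, ∀ V' ∈ Rd, Valued.v (V - V') ≤ Valued.v ϖ ^ (2 * d) → V = V')
    (R' : Finset K) (hR'1 : ∀ V ∈ R', σ V = V ∧ Valued.v V ≤ 1)
    (hR'2 : ∀ V : K, σ V = V → Valued.v V ≤ 1 → ∃ V₀ ∈ R', Valued.v (V - V₀) ≤ Valued.v ϖ ^ 2)
    (hR'3 : ∀ V ∈ R', ∀ V' ∈ R', Valued.v (V - V') ≤ Valued.v ϖ ^ 2 → V = V')
    (LIT : K → Prop) [DecidablePred LIT]
    (hLIT : ∀ V V' : K, σ V = V → Valued.v V ≤ 1 → σ V' = V' → Valued.v V' ≤ 1 → Valued.v (V - V') ≤ Valued.v ϖ ^ 2 → (LIT V ↔ LIT V'))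
    {s : ℤ} (hs : s = 1 ∨ s = -1) :
    (((Rd.filter LIT).filter fun V => Valued.v (α₁ + γ₁ * V) = 1).filter fun V => normSign σ (α₁ + γ₁ * V) = s).card =
      (((Rd.filter LIT).filter fun V => Valued.v (α₁ + γ₁ * V) = 1).filter fun V => ¬ normSign σ (α₁ + γ₁ * V) = s).card := by
  classical
  have key := card_filter_unitAffine_plus_eq_card_filter_not hD h2v hd2 hσα hσγ hγ Rd hRd1 hRd2 hRd3 R' hR'1 hR'2 hR'3 LIT hLIT
  rcases hs with rfl | rfl
  · exact key
  · -- `ω = −1 ↔ ¬ ω = 1` and `¬ ω = −1 ↔ ω = 1`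
    set S : Finset K := (Rd.filter LIT).filter fun V => Valued.v (α₁ + γ₁ * V) = 1
    have h1 : (S.filter fun V => normSign σ (α₁ + γ₁ * V) = -1) = S.filter fun V => ¬ normSign σ (α₁ + γ₁ * V) = 1 := by
      refine filter_congr fun V _ => ?_
      rcases normSign_eq_one_or σ (α₁ + γ₁ * V) with h | h
      · rw [h]; norm_num
      · rw [h]; norm_num
    have h2 : (S.filter fun V => ¬ normSign σ (α₁ + γ₁ * V) = -1) = S.filter fun V => normSign σ (α₁ + γ₁ * V) = 1 := by
      refine filter_congr fun V _ => ?_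
      rcases normSign_eq_one_or σ (α₁ + γ₁ * V) with h | h
      · rw [h]; norm_num
      · rw [h]; norm_num
    rw [h1, h2]
    exact key.symm

end Summit.HodgeConjecture.HodgeConjecture.Cruxes.H413.F0P3cDyRamUnitAffineDigitCount

end
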